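import Summits.Parity.GeneralizedHardyLittlewood.Theses.LiouvilleShiftedTables
import Summits.Parity.GeneralizedHardyLittlewood.Theses.RoughSemiprimeRigidity
import Literature.NumberTheory.Sieve.ElliottHalberstamBridgeProofs
import Literature.NumberTheory.Sieve.BombieriVinogradovFacts
import Summits.Parity.GeneralizedHardyLittlewood.Theorems.LiouvilleShiftedTablesEHStubLowConductor
import Summits.Parity.GeneralizedHardyLittlewood.Theorems.LiouvilleShiftedTablesEHStubReplication
import Summits.Parity.GeneralizedHardyLittlewood.Theorems.LiouvilleShiftedTablesEHStubBadModuliSparse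
import Summits.Parity.GeneralizedHardyLittlewood.Theorems.LiouvilleShiftedTablesEHStubDescent
import Summits.Parity.GeneralizedHardyLittlewood.Theorems.LiouvilleShiftedTablesEHStubPurityOfWindowMoment

/-!
# Line `upward-replication-free-factorability` — crux `EH` (stmt-Parity-11314), lead's skeleton

Reshape 2 (lead prover-line-stmt-Parity-11314-1, 2026-08-16): the open stub `stub_topWindowPurity` is
split at the skeleton level into `stub_windowMoment` (OPEN, conjecture-grade: a power saving in the
`2k`-th moment of the maximal conductor-excised discrepancy over the window, outside a power-sparse
exceptional set — the moment-ladder card's top rung in the tree's vocabulary) and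
`stub_purity_of_windowMoment` (Markov; provable now); `stub_topWindowPurity` is derived from the two
and `EH_of` is unchanged.  Registered stubs after the reshape: `stub_lowConductor`, `stub_replication`,
`stub_windowMoment`, `stub_purity_of_windowMoment`, `stub_badModuliSparse`, `stub_descent` (6 ≤ 7);
all but `stub_windowMoment` are landed theorems (`stub_purity_of_windowMoment`: p96509; bridges
`Theorems.EH.OfWindowMoments.eh_of_windowMoments` / `eh_level_of_momentAt`: p97201).  ONE `sorry` = the open stub.

Reshaped by the line lead (prover-line-stmt-Parity-11314-0, 2026-08-16) from the planner's
`Lines/upward_replication_free_factorability.lean`: the SAME composition (low-conductor part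
harmless at every level + replication inequality for the conductor-excised discrepancy `Δ♯` +
power-sparse purity of one top window + a counting descent ⟹ the Wave0 form of Elliott–Halberstam,
then the PROVED tree equivalence `elliottHalberstam_iff_wave0_holds`), with three changes that make
the stubs landable as stand-alone `--supports` files:

* every stub signature is SELF-CONTAINED over Mathlib + `Literature` (fully qualified names, no
  local definitions), so a stub file under `Theorems/` restates it verbatim;
* the conductor cut is the natural number `⌊x^{1/2−δ₀}⌋₊` (so `D < cond χ` is decided in `ℕ`), the
  replication lemma is stated for an ARBITRARY cut `D : ℕ` with the tree's remainder
  `nonCoprimePart (q·p) x` (≤ ⌊log x/log 2⌋ log(qp), `nonCoprimePart_le`) as its additive term, and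
  purity is stated with an explicit exceptional SET `I` (no decidability in the statement);
* the planner's `stub_descent` is split at the skeleton level into the number-theoretic counting
  lemma `stub_badModuliSparse` (PNT in `(P, 2P]` + "an integer `≤ 2x` has `< 2/κ` prime factors
  `> x^κ`") and the bookkeeping `stub_descent` (5 registered stubs + the open one = 6 ≤ stubs_max).

Objects (all at height `x`; `ψ(x, χ) = Literature.NumberTheory.Sieve.chebyshevPsiChar χ x`,
`ψ(x; q, a) = Literature.NumberTheory.Sieve.ParityWave0.chebyshevPsiMod q a x`):
* `Δ♯_D(x; q, a) = φ(q)⁻¹ ∑_{χ mod q, cond χ > D} χ(a⁻¹) ψ(x, χ)` (high-conductor part of the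
  discrepancy `Δ(x; q, a) = ψ(x; q, a) − x/φ(q)`, Davenport ch. 28 / Mathlib
  `ArithmeticFunction.vonMangoldt.residueClass_apply`), `E♯_D(x; q) = max_{a unit} ‖Δ♯_D(x; q, a)‖`;
* `E♭_D(x; q) = max_{a unit} ‖Δ(x; q, a) − Δ♯_D(x; q, a)‖` (by orthogonality the characters of
  conductor `≤ D`, including `ψ(x, χ₀) − x`; DEFINED as the remainder so that `|Δ| ≤ E♭ + E♯` is the
  triangle inequality).

Disproof used: the landed `Theorems/EH/Negative/EHFloor.lean` (cdisprove): `θ < 1` and `0 < ε` are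
load-bearing for `EH` — honoured (`stub_descent` produces the Wave0 form `∀ θ < 1, EH θ`, and the
window sits strictly above the level: `0 < 1 − ε' − θ` in `stub_badModuliSparse`); none of the
refuted shapes (closed endpoint, log-level, uniform power saving) occurs: the only power saving is in
the COUNT of impure / bad moduli.
-/

namespace Summit.Parity.GeneralizedHardyLittlewood.Cruxes.EH.UpwardReplicationFreeFactorability

/-! ### Registered stubs (self-contained signatures) -/

/-- Stub 1 (KNOWN, size L) — **low conductors are harmless at every level**: for `0 < δ₀ < 1/2`,
`θ < 1`, `A > 0`, `∑_{q ≤ x^θ} E♭_{⌊x^{1/2−δ₀}⌋}(x; q) = O(x/(log x)^A)`.  Proof route: the exact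
character expansion `Δ(x;q,a) = φ(q)⁻¹∑_χ χ(a⁻¹)ψ'(x,χ)` (`residueClass_apply`, as in the tree's
`abs_chebyshevPsiMod_sub_le`) leaves `φ(q)⁻¹∑_{cond χ ≤ D} χ(a⁻¹)ψ'(x,χ)`; then the Bombieri–Vinogradov
reduction of `BombieriVinogradovReduction.lean` with the conductor capped at `D = x^{1/2−δ₀}` instead
of the level: reindex by `(d, χ₁)`, `d ∣ q`, `d ≤ D` (`norm_psiPrime_changeLevel_le`,
`sum_filter_dvd_totient_inv_le`, `totientInvSum_le`), Siegel–Walfisz range `primTerm_le_of_SW` +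
`swBound_of_siegel_walfisz siegel_walfisz_holds`, Vaughan range `sum_Ioc_primTerm_le` +
`vaughanBound_of_vaughan_meanValue vaughan_meanValue_holds` (largest term `x^{1/2}·D·log⁴ = x^{1−δ₀}log⁴`),
remainders `nonCoprimePart_le` (total `≪ x^θ log⁴ x`). -/
theorem stub_lowConductor :
    ∀ δ₀ : ℝ, 0 < δ₀ → δ₀ < 1 / 2 → ∀ θ : ℝ, θ < 1 → ∀ A : ℝ, 0 < A →
      (fun x : ℝ => ∑ q ∈ Finset.Icc 1 ⌊x ^ θ⌋₊, ⨆ a : (ZMod q)ˣ,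
          ‖((Literature.NumberTheory.Sieve.ParityWave0.chebyshevPsiMod q (a : ZMod q) x -
                  x / (Nat.totient q : ℝ) : ℝ) : ℂ) -
              ((Nat.totient q : ℂ))⁻¹ *
                ∑ χ ∈ (Finset.univ : Finset (DirichletCharacter ℂ q)) with
                    ⌊x ^ (1 / 2 - δ₀)⌋₊ < χ.conductor,
                  χ (a : ZMod q)⁻¹ * Literature.NumberTheory.Sieve.chebyshevPsiChar χ x‖) =O[Filter.atTop]
        fun x : ℝ => x / Real.log x ^ A :=
  -- landed: Summit.Parity.GeneralizedHardyLittlewood.Theorems.EH.LowConductor.stub_lowConductor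
  Summit.Parity.GeneralizedHardyLittlewood.Theorems.EH.LowConductor.stub_lowConductor

/-- Stub 2 (the lever, size M) — **replication inequality for `Δ♯`**: for any cut `D`, `x ≥ 1`,
`q ≥ 1` and a prime `p ∤ q`, `E♯_D(x; q) ≤ (p − 1)·E♯_D(x; q·p) + R(qp, x)` with
`R(m, x) = ∑_{n ≤ x, (n,m) > 1} Λ(n)` (`Literature.NumberTheory.Sieve.nonCoprimePart`).  Proof route: for a unit `a mod q`
sum `Δ♯_D(x; qp, a')` over the fibre of `a` under `ZMod.unitsMap (q ∣ qp)` (a coset of the kernel `K`,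
`#K = φ(qp)/φ(q) = p − 1` by `ZMod.unitsMap_surjective`, `Nat.totient_mul`); `∑_{k ∈ K} χ(k) = #K` if
`χ` is trivial on `K`, else `0`; trivial on `K` iff `χ = changeLevel χ₁`
(`DirichletCharacter.factorsThrough_iff_ker_unitsMap`, `changeLevel_injective`), same conductor
(`DirichletCharacter.conductor_changeLevel`); and `‖ψ(x, changeLevel χ₁) − ψ(x, χ₁)‖ ≤ R(qp, x)`
(`Literature.NumberTheory.Sieve.norm_chebyshevPsiChar_changeLevel_sub_le`), `#{χ₁ mod q} = φ(q)`. -/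
theorem stub_replication :
    ∀ (D : ℕ) (x : ℝ), 1 ≤ x → ∀ q : ℕ, 1 ≤ q → ∀ p : ℕ, p.Prime → ¬ p ∣ q →
      (⨆ a : (ZMod q)ˣ,
          ‖((Nat.totient q : ℂ))⁻¹ *
              ∑ χ ∈ (Finset.univ : Finset (DirichletCharacter ℂ q)) with D < χ.conductor,
                χ (a : ZMod q)⁻¹ * Literature.NumberTheory.Sieve.chebyshevPsiChar χ x‖) ≤
        ((p : ℝ) - 1) *
            (⨆ a : (ZMod (q * p))ˣ,
              ‖((Nat.totient (q * p) : ℂ))⁻¹ *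
                  ∑ χ ∈ (Finset.univ : Finset (DirichletCharacter ℂ (q * p))) with D < χ.conductor,
                    χ (a : ZMod (q * p))⁻¹ * Literature.NumberTheory.Sieve.chebyshevPsiChar χ x‖) +
          Literature.NumberTheory.Sieve.nonCoprimePart (q * p) x :=
  -- landed: Summit.Parity.GeneralizedHardyLittlewood.Theorems.EH.Replication.stub_replication
  Summit.Parity.GeneralizedHardyLittlewood.Theorems.EH.Replication.stub_replication

/-- Stub 3a (OPEN, conjecture-grade — the hardest stub, held by the lead) — **window moment bound**
(reshape 2026-08-16 by lead prover-line-stmt-Parity-11314-1 of the former `stub_topWindowPurity`, which is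
now DERIVED below from 3a + 3b): for every window exponent `0 < ε' ≤ 1/2` there are a conductor cut
`δ₀ ∈ (0, 1/2)`, an order `k`, a saving `η > 0` and `x₀` such that for `x ≥ x₀`, outside an exceptional
set `E` of `≤ x^{1−ε'−η}` moduli, the `2k`-th moment over the window `m ∈ (M, 2M]`, `M = x^{1−ε'}`, of the
MAXIMAL conductor-excised discrepancy `E♯(x; m) = max_{a unit} ‖Δ♯_{⌊x^{1/2−δ₀}⌋}(x; m, a)‖` has a power
saving over the purity threshold: `∑_{m ∼ M, m ∉ E} E♯(x; m)^{2k} ≤ x^{2k−η} / M^{2k−1}`.  This is the top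
rung of the moment-ladder card (`Cruxes/EH/Ideas/moment-ladder-pattern-complexity.md`, `MomentRung k` at
`Q = M`) in the tree's vocabulary and in its weakest, max-inside form (the rung's `∑_a ‖Δ♯‖^{2k}`
dominates `E♯^{2k}`).  Consistent with the random model iff `k ε' > η` (max-inside) — the sum-over-`a`
rung needs `k > (1−ε')/ε'`; implied by Montgomery's conjecture for `Δ♯`; KNOWN only for `k = 1` and
`ε' > 1/2` (Barban–Davenport–Halberstam / large sieve: `(M + x^{1/2+δ₀}) x log² x`), i.e. never in the
registered range `ε' ≤ 1/2`; no `2k`-th moment with `k ≥ 2` is in print for any `M ≤ x^{1−δ}` (third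
moments: Hooley BDH VIII–IX, Vaughan 2003, only `M > x/(log x)^A`).  Not worked by stub workers. -/
theorem stub_windowMoment :
    ∀ ε' : ℝ, 0 < ε' → ε' ≤ 1 / 2 →
      ∃ δ₀ : ℝ, 0 < δ₀ ∧ δ₀ < 1 / 2 ∧ ∃ k : ℕ, ∃ η : ℝ, 0 < η ∧ ∃ x₀ : ℝ, ∀ x : ℝ, x₀ ≤ x →
        ∃ E : Finset ℕ, (E.card : ℝ) ≤ x ^ (1 - ε' - η) ∧
          ∑ m ∈ (Finset.Ioc ⌊x ^ (1 - ε')⌋₊ ⌊2 * x ^ (1 - ε')⌋₊ \ E),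
              (⨆ a : (ZMod m)ˣ,
                  ‖((Nat.totient m : ℂ))⁻¹ *
                      ∑ χ ∈ (Finset.univ : Finset (DirichletCharacter ℂ m)) with
                          ⌊x ^ (1 / 2 - δ₀)⌋₊ < χ.conductor,
                        χ (a : ZMod m)⁻¹ * Literature.NumberTheory.Sieve.chebyshevPsiChar χ x‖) ^ (2 * k) ≤
            x ^ (2 * (k : ℝ) - η) / (x ^ (1 - ε')) ^ (2 * (k : ℝ) - 1) := by
  sorry

/-- Stub 3b (LANDED p96509 — Markov's inequality) — **purity from the window moment bound**: the
statement of stub 3a implies top-window purity (the statement of the former stub 3, verbatim): given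
`ε', B`, take `δ₀, k, η, x₀` from 3a; for `x ≥ x₀` put `I := E ∪ {m ∼ M, m ∉ E impure}`; an impure `m`
(`E♯(x;m) ≥ x/(φ(m)(log x)^B) ≥ x/(2M(log x)^B)` since `φ(m) ≤ m ≤ 2M`) contributes `≥ (x/(2M(log x)^B))^{2k}`
to the moment, so `#impure ≤ x^{2k−η}M^{1−2k}·(2M(log x)^B/x)^{2k} = 4^k x^{1−ε'−η}(log x)^{2kB}`, and
`#I ≤ x^{1−ε'−η}(1 + 4^k(log x)^{2kB}) ≤ x^{1−ε'−η/2}` for `x ≥ x₁(k, B, η)`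
(`isLittleO_log_rpow_rpow_atTop`).  Output: `δ₀, η/2, max x₀ x₁`. -/
theorem stub_purity_of_windowMoment :
    (∀ ε' : ℝ, 0 < ε' → ε' ≤ 1 / 2 →
      ∃ δ₀ : ℝ, 0 < δ₀ ∧ δ₀ < 1 / 2 ∧ ∃ k : ℕ, ∃ η : ℝ, 0 < η ∧ ∃ x₀ : ℝ, ∀ x : ℝ, x₀ ≤ x →
        ∃ E : Finset ℕ, (E.card : ℝ) ≤ x ^ (1 - ε' - η) ∧
          ∑ m ∈ (Finset.Ioc ⌊x ^ (1 - ε')⌋₊ ⌊2 * x ^ (1 - ε')⌋₊ \ E),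
              (⨆ a : (ZMod m)ˣ,
                  ‖((Nat.totient m : ℂ))⁻¹ *
                      ∑ χ ∈ (Finset.univ : Finset (DirichletCharacter ℂ m)) with
                          ⌊x ^ (1 / 2 - δ₀)⌋₊ < χ.conductor,
                        χ (a : ZMod m)⁻¹ * Literature.NumberTheory.Sieve.chebyshevPsiChar χ x‖) ^ (2 * k) ≤
            x ^ (2 * (k : ℝ) - η) / (x ^ (1 - ε')) ^ (2 * (k : ℝ) - 1)) →
    ∀ ε' : ℝ, 0 < ε' → ε' ≤ 1 / 2 → ∀ B : ℝ, 0 < B →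
      ∃ δ₀ : ℝ, 0 < δ₀ ∧ δ₀ < 1 / 2 ∧ ∃ η : ℝ, 0 < η ∧ ∃ x₀ : ℝ, ∀ x : ℝ, x₀ ≤ x →
        ∃ I : Finset ℕ, (I.card : ℝ) ≤ x ^ (1 - ε' - η) ∧
          ∀ m ∈ Finset.Ioc ⌊x ^ (1 - ε')⌋₊ ⌊2 * x ^ (1 - ε')⌋₊, m ∉ I →
            (⨆ a : (ZMod m)ˣ,
                ‖((Nat.totient m : ℂ))⁻¹ *
                    ∑ χ ∈ (Finset.univ : Finset (DirichletCharacter ℂ m)) with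
                        ⌊x ^ (1 / 2 - δ₀)⌋₊ < χ.conductor,
                      χ (a : ZMod m)⁻¹ * Literature.NumberTheory.Sieve.chebyshevPsiChar χ x‖) <
              x / ((Nat.totient m : ℝ) * Real.log x ^ B) :=
  -- landed: Summit.Parity.GeneralizedHardyLittlewood.Theorems.EH.PurityOfMoment.stub_purity_of_windowMoment (p96509)
  Summit.Parity.GeneralizedHardyLittlewood.Theorems.EH.PurityOfMoment.stub_purity_of_windowMoment

/-- Former stub 3 (top-window purity), now DERIVED from stubs 3a + 3b: for every window exponent
`0 < ε' ≤ 1/2` and tolerance exponent `B > 0` there are a conductor cut `δ₀ ∈ (0, 1/2)`, a saving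
`η > 0` and `x₀` such that for `x ≥ x₀` all moduli `m ∈ (x^{1−ε'}, 2x^{1−ε'}]` outside an exceptional
set `I` of size `≤ x^{1−ε'−η}` are PURE: `E♯_{⌊x^{1/2−δ₀}⌋}(x; m) < x/(φ(m)(log x)^B)`.  Implied by
Montgomery's conjecture for `Δ♯`; not implied by EH (which gives only `(log x)^{−B'}` density);
beyond GRH; implies the crux (`Theorems.EH.OfTopWindowPurity.eh_of_topWindowPurity`, p89939). -/
theorem stub_topWindowPurity :
    ∀ ε' : ℝ, 0 < ε' → ε' ≤ 1 / 2 → ∀ B : ℝ, 0 < B →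
      ∃ δ₀ : ℝ, 0 < δ₀ ∧ δ₀ < 1 / 2 ∧ ∃ η : ℝ, 0 < η ∧ ∃ x₀ : ℝ, ∀ x : ℝ, x₀ ≤ x →
        ∃ I : Finset ℕ, (I.card : ℝ) ≤ x ^ (1 - ε' - η) ∧
          ∀ m ∈ Finset.Ioc ⌊x ^ (1 - ε')⌋₊ ⌊2 * x ^ (1 - ε')⌋₊, m ∉ I →
            (⨆ a : (ZMod m)ˣ,
                ‖((Nat.totient m : ℂ))⁻¹ *
                    ∑ χ ∈ (Finset.univ : Finset (DirichletCharacter ℂ m)) with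
                        ⌊x ^ (1 / 2 - δ₀)⌋₊ < χ.conductor,
                      χ (a : ZMod m)⁻¹ * Literature.NumberTheory.Sieve.chebyshevPsiChar χ x‖) <
              x / ((Nat.totient m : ℝ) * Real.log x ^ B) :=
  stub_purity_of_windowMoment stub_windowMoment

/-- Stub 4 (KNOWN, size M/L) — **bad moduli are sparse**: call `q ≤ x^θ` BAD (for a set `I`) when
every prime `p ∤ q` of the interval `(x^{1−ε'}/q, 2x^{1−ε'}/q]` has `q·p ∈ I`.  If
`#I ≤ x^{1−ε'−η}` and `κ := 1 − ε' − θ > 0`, then `∑_{q bad} 1/φ(q) ≤ K x^{−η} (log x)²` for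
`x ≥ x₁(ε', η, θ)`.  Proof route: each bad `q` yields `≥ x^{1−ε'}/(5 q log x)` pairs `(q, p)`
(primes in `(P, 2P]`, `P ≥ x^κ/2`: `θ(2P) − θ(P) ≥ P/2` eventually from the PROVED prime number
theorem `Literature.NumberTheory.LFunctions.chebyshevTheta_isEquivalent`, each prime weighing
`≤ log(2P)`, cf. `theta_sub_theta_le_card_primes_Ioc_mul_log` in
`Literature/Barriers/Parity/FordMaynardPrimeSievesProofs.lean`; minus the `< 1/κ` primes `> x^κ`
dividing `q`), the map `(q, p) ↦ q·p ∈ I` is at most `(1/κ + 1)`-to-one (an integer `≤ 2x` has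
`≤ 1/κ + 1` prime factors `> x^κ`, and `p` determines `q`), so `∑_{bad} 1/q ≤ (5 log x/x^{1−ε'})·#pairs
≤ (5/κ + 5) x^{−η} log x`; finally `q/φ(q) ≤ 3⁹ + 4e⁵ log log x` for `q ≤ 2x`
(`Literature.NumberTheory.Sieve.BrunGoldbach.self_div_totient_le`). -/
theorem stub_badModuliSparse :
    ∀ ε' η θ : ℝ, 0 < ε' → 0 < η → 0 < 1 - ε' - θ →
      ∃ K x₁ : ℝ, ∀ x : ℝ, x₁ ≤ x → ∀ I : Finset ℕ, (I.card : ℝ) ≤ x ^ (1 - ε' - η) →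
        ∀ Bad : Finset ℕ, Bad ⊆ Finset.Icc 1 ⌊x ^ θ⌋₊ →
          (∀ q ∈ Bad, ∀ p : ℕ, p.Prime → ¬ p ∣ q →
              x ^ (1 - ε') / q < p → (p : ℝ) ≤ 2 * x ^ (1 - ε') / q → q * p ∈ I) →
            ∑ q ∈ Bad, ((Nat.totient q : ℝ))⁻¹ ≤ K * x ^ (-η) * Real.log x ^ 2 :=
  -- landed: Summit.Parity.GeneralizedHardyLittlewood.Theorems.EH.BadModuliSparse.stub_badModuliSparse
  Summit.Parity.GeneralizedHardyLittlewood.Theorems.EH.BadModuliSparse.stub_badModuliSparse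

/-- Stub 5 (the transfer, size L) — **descent**: stubs 1–4 (as hypotheses, verbatim) give the Wave0
form `Literature.NumberTheory.Sieve.ElliottHalberstamConjecture = ∀ θ < 1, EH θ`
(`EH θ`: for every real `A`, `∑_{q ≤ x^θ} max_{a unit} |ψ(x;q,a) − x/φ(q)| = O(x/(log x)^A)`).
Proof route (all at height `x`; `A > 0` first, `A ≤ 0` from `A = 1`): fix `θ < 1`, `A > 0`; put
`ε' = min (1/2) ((1 − θ)/2)`, `B = A + 2`, take `δ₀, η, x₀` from purity and, for `x ≥ x₀`, its set
`I`; `D = ⌊x^{1/2−δ₀}⌋₊`.  For every unit `a`: `|Δ(x;q,a)| = ‖(Δ : ℂ)‖ ≤ E♭_D(x;q) + E♯_D(x;q)`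
(norm triangle + `le_ciSup` over the finite unit group).  GOOD `q` (some prime `p ∤ q` in
`(x^{1−ε'}/q, 2x^{1−ε'}/q]` with `qp ∉ I`; then `qp ∈ (⌊x^{1−ε'}⌋, ⌊2x^{1−ε'}⌋]`): replication and
purity give `E♯_D(x;q) ≤ (p−1)·x/(φ(qp)(log x)^B) + R(qp,x) = x/(φ(q)(log x)^B) + R(qp,x)`
(`Nat.totient_mul`, `Nat.totient_prime`), and `R(qp, x) ≤ ⌊log x/log 2⌋ log(2x)`
(`Literature.NumberTheory.Sieve.nonCoprimePart_le`); summing, `∑_q 1/φ(q) ≤ (1 + log x)²`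
(`Literature.NumberTheory.Sieve.totientInvSum_le`).  BAD `q` (the rest): the trivial bound
`0 ≤ ψ(x;q,a) ≤ (x/q + 1) log x` (`Literature.NumberTheory.LFunctions.PagePNT.chebyshevPsiMod_le_trivial`)
gives `max_a |Δ| ≤ (x log x + x)/φ(q) + log x`, and stub 4 bounds `∑_{bad} 1/φ(q)`.  Total:
`O(x/(log x)^A) + x(1 + log x)²/(log x)^{A+2} + x^θ·O(log² x) + (x log x + x)·K x^{−η} log² x + x^θ log x
= O(x/(log x)^A)`. -/
theorem stub_descent :
    (∀ δ₀ : ℝ, 0 < δ₀ → δ₀ < 1 / 2 → ∀ θ : ℝ, θ < 1 → ∀ A : ℝ, 0 < A →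
      (fun x : ℝ => ∑ q ∈ Finset.Icc 1 ⌊x ^ θ⌋₊, ⨆ a : (ZMod q)ˣ,
          ‖((Literature.NumberTheory.Sieve.ParityWave0.chebyshevPsiMod q (a : ZMod q) x -
                  x / (Nat.totient q : ℝ) : ℝ) : ℂ) -
              ((Nat.totient q : ℂ))⁻¹ *
                ∑ χ ∈ (Finset.univ : Finset (DirichletCharacter ℂ q)) with
                    ⌊x ^ (1 / 2 - δ₀)⌋₊ < χ.conductor,
                  χ (a : ZMod q)⁻¹ * Literature.NumberTheory.Sieve.chebyshevPsiChar χ x‖) =O[Filter.atTop]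
        fun x : ℝ => x / Real.log x ^ A) →
    (∀ (D : ℕ) (x : ℝ), 1 ≤ x → ∀ q : ℕ, 1 ≤ q → ∀ p : ℕ, p.Prime → ¬ p ∣ q →
      (⨆ a : (ZMod q)ˣ,
          ‖((Nat.totient q : ℂ))⁻¹ *
              ∑ χ ∈ (Finset.univ : Finset (DirichletCharacter ℂ q)) with D < χ.conductor,
                χ (a : ZMod q)⁻¹ * Literature.NumberTheory.Sieve.chebyshevPsiChar χ x‖) ≤
        ((p : ℝ) - 1) *
            (⨆ a : (ZMod (q * p))ˣ,
              ‖((Nat.totient (q * p) : ℂ))⁻¹ *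
                  ∑ χ ∈ (Finset.univ : Finset (DirichletCharacter ℂ (q * p))) with D < χ.conductor,
                    χ (a : ZMod (q * p))⁻¹ * Literature.NumberTheory.Sieve.chebyshevPsiChar χ x‖) +
          Literature.NumberTheory.Sieve.nonCoprimePart (q * p) x) →
    (∀ ε' : ℝ, 0 < ε' → ε' ≤ 1 / 2 → ∀ B : ℝ, 0 < B →
      ∃ δ₀ : ℝ, 0 < δ₀ ∧ δ₀ < 1 / 2 ∧ ∃ η : ℝ, 0 < η ∧ ∃ x₀ : ℝ, ∀ x : ℝ, x₀ ≤ x →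
        ∃ I : Finset ℕ, (I.card : ℝ) ≤ x ^ (1 - ε' - η) ∧
          ∀ m ∈ Finset.Ioc ⌊x ^ (1 - ε')⌋₊ ⌊2 * x ^ (1 - ε')⌋₊, m ∉ I →
            (⨆ a : (ZMod m)ˣ,
                ‖((Nat.totient m : ℂ))⁻¹ *
                    ∑ χ ∈ (Finset.univ : Finset (DirichletCharacter ℂ m)) with
                        ⌊x ^ (1 / 2 - δ₀)⌋₊ < χ.conductor,
                      χ (a : ZMod m)⁻¹ * Literature.NumberTheory.Sieve.chebyshevPsiChar χ x‖) <
              x / ((Nat.totient m : ℝ) * Real.log x ^ B)) →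
    (∀ ε' η θ : ℝ, 0 < ε' → 0 < η → 0 < 1 - ε' - θ →
      ∃ K x₁ : ℝ, ∀ x : ℝ, x₁ ≤ x → ∀ I : Finset ℕ, (I.card : ℝ) ≤ x ^ (1 - ε' - η) →
        ∀ Bad : Finset ℕ, Bad ⊆ Finset.Icc 1 ⌊x ^ θ⌋₊ →
          (∀ q ∈ Bad, ∀ p : ℕ, p.Prime → ¬ p ∣ q →
              x ^ (1 - ε') / q < p → (p : ℝ) ≤ 2 * x ^ (1 - ε') / q → q * p ∈ I) →
            ∑ q ∈ Bad, ((Nat.totient q : ℝ))⁻¹ ≤ K * x ^ (-η) * Real.log x ^ 2) →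
    Literature.NumberTheory.Sieve.ElliottHalberstamConjecture :=
  -- landed: Summit.Parity.GeneralizedHardyLittlewood.Theorems.EH.Descent.stub_descent
  Summit.Parity.GeneralizedHardyLittlewood.Theorems.EH.Descent.stub_descent

/-! ### Composition -/

/-- **The line concludes the crux BY NAME.** The route decl `EH` (Elliott–Halberstam with `max_{y ≤ x}`,
level `x^{θ−ε}`, `A > 0`; `Iff.rfl` with `LevelOfDistribution.ElliottHalberstam`) from the five
registered stubs: the descent yields the Wave0 form `∀ θ < 1, EH θ`, and the PROVED tree equivalence
`Literature.NumberTheory.Sieve.elliottHalberstam_iff_wave0_holds` (Iwaniec–Kowalski §17.1 grid argument)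
restores the maximum over `y ≤ x` and the `ε`-slack of the level.  `sorry` occurs only inside the
stubs. -/
theorem EH_of : Summit.Parity.GeneralizedHardyLittlewood.Theses.LiouvilleShiftedTables.EH :=
  Literature.NumberTheory.Sieve.elliottHalberstam_iff_wave0_holds.mpr
    (stub_descent stub_lowConductor stub_replication stub_topWindowPurity stub_badModuliSparse)

/-- The same conclusion for the second route wanting the crux: `RoughSemiprimeRigidity.EH` has the
byte-identical body, so `EH_of` proves it by definitional unfolding. -/
theorem EH_of_roughSemiprimeRigidity :
    Summit.Parity.GeneralizedHardyLittlewood.Theses.RoughSemiprimeRigidity.EH :=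
  EH_of

end Summit.Parity.GeneralizedHardyLittlewood.Cruxes.EH.UpwardReplicationFreeFactorability
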